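import Literature.NumberTheory.GaloisRepresentations.GalLayerSystemRelInfInjective
import Literature.NumberTheory.GaloisRepresentations.IdeleTruncatedSLocalization
import Literature.NumberTheory.GaloisRepresentations.AbsGaloisGroupCompact
import Literature.Algebra.Homology.DiscreteRepLayerInflationPullback
import Literature.Algebra.Homology.DiscreteRepCoindPullbackShapiro
import Literature.Algebra.Homology.DiscreteRepLayerBoundary
import HarnessLib

/-!
# Local inflation is injective on `H²(·, K̄_wˣ)`, read in the currency of the permutation dévissage
# (Serre, *Local Fields* X §4 Prop. 6: `Br(E/F_V) ↪ Br(F_V)`; C–F VII §11.1)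

Topic `NumberTheory/GaloisRepresentations`; namespace `Literature.NumberTheory.GaloisRepresentations`.
Theorems only (no definition, no named fact, no instance, no notation, no `sorry`); any field `F` with `F̄/F`
Galois and `Γ_F` compact in §2–§3, the completions `K_w` of a number field in §4.

THE POINT.  bsd-eis -w3 g18's `unitsDataGal_relInflG_two_injective` (file `GalLayerSystemRelInfInjective`, brick
[P2-c] of the scoping memo `P2-MONO-SCOPING-w3g18-v2.md`) proves that for an open subgroup `V ≤ Γ_F` and a finite
Galois layer `E/F` with `U_E ≤ V` the inflation `H²(H_E, Eˣ) → Ext²_{C_V}(ℤ, Res_V lim→ E'ˣ)` is injective — in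
the currency of the Galois LAYER SYSTEM `unitsDataGal F` (module `(unitsDataGal F).toSystem.toD`, source read
through door-c6's `relLayerCohomologyIso`).  The consumer — hypothesis [P2-mono] of the permutation dévissage of
(Λ2) of Milne's `Ext` road (-w4 g20 `IdeleReadout.idLocMap_injective_two_of_inputs''`, binder
`P2mono`) — meets the local inflation in ANOTHER currency: after bsd-eis -w7 g13's pull-back formula
`LayerColimit.mapExactFunctor_resDHom_inflG` (`φ^* (Inf_V c) = Inf_{φ⁻¹V} (…)`) along the conjugated decomposition
map `ψ_s = conjHom φ_w U s : V_w = φ_w⁻¹U → U` and door-c4's `LayerColimit.inflG_map` (naturality in the module)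
applied to -w4 g20's conjugated coefficient map `conjCoeff … (locQ K S w) s : Res_{ψ_s} Res_U I_S ⟶ Res_{V_w} K̄_wˣ`,
the `(w, t)`-component of a class inflated from the trace layer `U ∩ V̄_E` of `U` is

  `LayerColimit.inflG (comapOpenNormalSubgroup ψ_s _ (traceOpenNormalSubgroup U V̄_E)) ((resD ℤ V_w).obj (unitsD K_w)) 2 c'`

— door-c4's `inflG` for the group `V_w`, the open normal subgroup `ψ_s⁻¹(U ∩ V̄_E)` and the module
`Res_{V_w} K̄_wˣ` ON THE NOSE.  This file proves THAT map injective, so that [P2-mono]'s hypothesis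
«every `(w, t)`-component vanishes» becomes «every finite-level class `c'` vanishes» with no identification left
to the consumer:

* §1 `inflG_injective_of_iso`: injectivity of `inflG N M n` is transported along an isomorphism `M ≅ M'`
  (door-c4 `inflG_map` + functoriality of Mathlib's `groupCohomology.functor`);
* §2 **`inflG_trace_res_units_two_injective`**: for `V ≤ Γ_F` open and `W ≤ V` open normal in `Γ_F`,
  `inflG (traceOpenNormalSubgroup V W) ((resD ℤ V).obj K̄ˣ) 2` is injective (`K̄ˣ = ofDiscreteGaloisModule (units F)`
  = -w4 g20's `unitsD F`): -w3's theorem at the layer `E = F̄^W` (`GalLayer.ofOpenNormalSubgroupGal`, `U_E = W`)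
  transported along `(resD V).mapIso (unitsBarIsoGal F)`; and the same for ANY open normal `N ≤ V` that is
  propositionally `W ∩ V` (`inflG_res_units_two_injective_of_coe_eq`, no dependent rewriting under `inflG`);
* §3 **`inflG_comap_conjHom_res_units_two_injective`**: the subgroup `ψ_s⁻¹(U ∩ V̄)` of `V_w = φ⁻¹U` IS `φ⁻¹V̄ ∩ V_w`
  (`coe_comapOpenNormalSubgroup_conjHom_trace`, normality of `V̄`), hence §2 applies to the displayed map above for
  any continuous `φ : Γ_F → G`, `U ≤ G` open normal, `s ∈ G`, `V̄ ≤ U` open normal;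
* §4 the number-field instances at `F := K_w = Place.Completion w` (any place `w`, finite or infinite),
  `φ := decompMapPlaceS K S w`, module `unitsD (Place.Completion w)`:
  **`inflG_comap_conjHom_res_unitsD_completion_two_injective`** and `inflG_res_unitsD_completion_two_injective_of_coe_eq`.

Written for lane «PT-Ш-S-TC» of cell `bsd-eis` (crux `stmt-BirchSwinnertonDyer-19032`), brick [P2-mono] file P2-e
(local leaf), seat bsd-line-x1-p1-w4 gen 21.  HONEST FRAMING: a functoriality/transport statement about the Brauer
inflation; no arithmetic duality statement and no case of BSD is proved here.  AI formalisation, established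
only by the kernel check.

## References
* J.-P. Serre, *Local Fields*, GTM 67 (1979), X §4 Proposition 6 (inflation `Br(E/K) → Br(K)` injective). [Serre1979]
* J. W. S. Cassels, A. Fröhlich (eds.), *Algebraic Number Theory* (1967), Ch. VII (J. Tate) §11.1. [CasselsFrohlichANT1967]
* J.-P. Serre, *Galois Cohomology*, Springer (1997), I §2.2 Proposition 8 (compatibility of inflation with the
  limit over open normal subgroups). [SerreGaloisCohomology1997]
* D. Harari, *Galois Cohomology and Class Field Theory*, Universitext (2020), §4.3 (2)–(3), §17.5 Lemma 17.23. [Harari2020]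
-/

noncomputable section

open CategoryTheory CategoryTheory.Abelian Function
open Field (absoluteGaloisGroup)
open Literature.Algebra.Homology Literature.Algebra.Homology.DiscreteRep

namespace Literature.NumberTheory.GaloisRepresentations

/-! ## §1 Transport of the injectivity of `inflG` along an isomorphism of modules -/

section Transport

universe u

variable {k Γ : Type u} [CommRing k] [Group Γ] [TopologicalSpace Γ] [IsTopologicalGroup Γ]

/-- **Injectivity of door-c4's `inflG N M n` is invariant under isomorphisms `M ≅ M'`**: by `inflG_map`,
`Inf_N^{M'} (Hⁿ(id, e^N) c) = Inf_N^M c ∘ [e]`, where `Hⁿ(id, e^N)` is an isomorphism of the layers and `∘ [e]` is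
injective. [cite: SerreGaloisCohomology1997, I §2.2 Proposition 8] -/
theorem inflG_injective_of_iso (N : OpenNormalSubgroup Γ) {M M' : DiscreteRepCat k Γ} (e : M ≅ M') (n : ℕ)
    (h : Injective (LayerColimit.inflG N M n)) : Injective (LayerColimit.inflG N M' n) := by
  -- the induced isomorphism of the finite layers `Hⁿ(Γ ⧸ N, M^N) ≅ Hⁿ(Γ ⧸ N, M'^N)`
  let eN : groupCohomology ((invariantsQuotFunctor k (N : Subgroup Γ)).obj M) n ≅
      groupCohomology ((invariantsQuotFunctor k (N : Subgroup Γ)).obj M') n :=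
    (groupCohomology.functor k _ n).mapIso ((invariantsQuotFunctor k (N : Subgroup Γ)).mapIso e)
  have hsurj : Surjective eN.hom.hom := fun c' =>
    ⟨eN.inv.hom c', by
      change (eN.inv ≫ eN.hom).hom c' = c'
      rw [eN.inv_hom_id]
      rfl⟩
  refine (injective_iff_map_eq_zero _).2 fun c' hc' => ?_
  obtain ⟨c, rfl⟩ := hsurj c'
  -- `Inf^{M'} (e_* c) = Inf^M c ∘ [e.hom]`
  have key : LayerColimit.inflG N M' n (eN.hom.hom c) =
      (LayerColimit.inflG N M n c).comp (Ext.mk₀ e.hom) (add_zero n) :=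
    LayerColimit.inflG_map N e.hom n c
  have hM : LayerColimit.inflG N M n c = 0 := by
    have hc : LayerColimit.inflG N M n c =
        ((LayerColimit.inflG N M n c).comp (Ext.mk₀ e.hom) (add_zero n)).comp (Ext.mk₀ e.inv) (add_zero n) := by
      rw [Ext.comp_assoc_of_second_deg_zero, Ext.mk₀_comp_mk₀, Iso.hom_inv_id, Ext.comp_mk₀_id]
    rw [hc, ← key, hc', Ext.zero_comp]
  rw [h (hM.trans (map_zero _).symm), map_zero]

end Transport

/-! ## §2 `Inf : H²(V ⧸ (W ∩ V), (K̄ˣ)^W) → Ext²_{C_V}(ℤ, Res_V K̄ˣ)` is injective (`V ≤ Γ_F` open, `W ≤ V` open normal in `Γ_F`) -/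

section AnyField

open IdeleClassBar (GalLayer)

variable (F : Type) [Field F] [IsGalois F (AlgebraicClosure F)] [CompactSpace (absoluteGaloisGroup F)]

/-- **Local Brauer inflation injectivity, `unitsD` currency**: for `F̄/F` Galois with `Γ_F` compact, `V ≤ Γ_F` open and
`W ≤ V` an open normal subgroup of `Γ_F`, door-c4's inflation from the trace layer `W ∩ V` of the group `V`,
`inflG (traceOpenNormalSubgroup V W) ((resD ℤ V).obj K̄ˣ) 2 : H²(V ⧸ W, (K̄ˣ)^W) → Ext²_{C_V}(ℤ, Res_V K̄ˣ)`, is injective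
— bsd-eis -w3 g18's `unitsDataGal_relInflG_two_injective` at the layer `E = F̄^W` (`U_E = W`), transported from the
layer-system module `(unitsDataGal F).toSystem.toD` to `K̄ˣ = ofDiscreteGaloisModule (units F)` along `unitsBarIsoGal`.
[cite: Serre1979, X §4 Proposition 6][cite: CasselsFrohlichANT1967, Ch. VII §11.1] -/
theorem inflG_trace_res_units_two_injective (V : Subgroup (absoluteGaloisGroup F))
    (hV : IsOpen (V : Set (absoluteGaloisGroup F))) (W : OpenNormalSubgroup (absoluteGaloisGroup F))
    (hW : (W : Subgroup (absoluteGaloisGroup F)) ≤ V) :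
    Injective (LayerColimit.inflG (traceOpenNormalSubgroup V W)
      ((resD ℤ V).obj (ofDiscreteGaloisModule (DiscreteGaloisModule.units F))) 2) := by
  -- (1) the layer-system statement at `E := F̄^W`
  have hE : ((GalLayer.ofOpenNormalSubgroupGal W).openNormalSubgroup : Subgroup (absoluteGaloisGroup F)) ≤ V := by
    rw [GalLayer.openNormalSubgroup_ofOpenNormalSubgroupGal]; exact hW
  have h0 := unitsDataGal_relInflG_two_injective F V hE hV
  -- (2) strip door-c6's `relLayerCohomologyIso` (an isomorphism on the source)
  have h1 : Injective (LayerColimit.inflG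
      (traceOpenNormalSubgroup V (GalLayer.ofOpenNormalSubgroupGal W).openNormalSubgroup)
      ((resD ℤ V).obj (unitsDataGal F).toSystem.toD) 2) := by
    intro a b hab
    have hab' : (unitsDataGal F).relInflG V hE 2 (((unitsDataGal F).relLayerCohomologyIso hE 2).hom a) =
        (unitsDataGal F).relInflG V hE 2 (((unitsDataGal F).relLayerCohomologyIso hE 2).hom b) := by
      rw [GalLayerData.relInflG_apply, GalLayerData.relInflG_apply, Iso.hom_inv_id_apply, Iso.hom_inv_id_apply]
      exact hab
    have := congrArg (fun x => ((unitsDataGal F).relLayerCohomologyIso hE 2).inv x) (h0 hab')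
    simpa only [Iso.hom_inv_id_apply] using this
  -- (3) `U_{F̄^W} = W`
  rw [GalLayer.openNormalSubgroup_ofOpenNormalSubgroupGal] at h1
  -- (4) transport the module along `Res_V (unitsBarIsoGal F)`
  exact inflG_injective_of_iso _ ((resD ℤ V).mapIso (unitsBarIsoGal F)) 2 h1

/-- **The same for any open normal subgroup `N ≤ V` that is PROPOSITIONALLY the trace `W ∩ V`** (stated with an
equation of subgroups, so that a consumer whose `N` is built differently — e.g. as a preimage — never rewrites under
the dependent type of `inflG`). [cite: Serre1979, X §4 Proposition 6][cite: SerreGaloisCohomology1997, I §2.2 Proposition 8] -/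
theorem inflG_res_units_two_injective_of_coe_eq (V : Subgroup (absoluteGaloisGroup F))
    (hV : IsOpen (V : Set (absoluteGaloisGroup F))) (W : OpenNormalSubgroup (absoluteGaloisGroup F))
    (hW : (W : Subgroup (absoluteGaloisGroup F)) ≤ V) (N : OpenNormalSubgroup V)
    (hN : (N : Subgroup V) = (W : Subgroup (absoluteGaloisGroup F)).subgroupOf V) :
    Injective (LayerColimit.inflG N ((resD ℤ V).obj (ofDiscreteGaloisModule (DiscreteGaloisModule.units F))) 2) := by
  obtain rfl : N = traceOpenNormalSubgroup V W :=
    OpenNormalSubgroup.toSubgroup_injective (hN.trans (coe_traceOpenNormalSubgroup V W).symm)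
  exact inflG_trace_res_units_two_injective F V hV W hW

/-! ## §3 The open normal subgroup `ψ_s⁻¹(U ∩ V̄)` of `V_w = φ⁻¹U` met by the dévissage is `φ⁻¹V̄ ∩ V_w` -/

variable {G : Type} [Group G] [TopologicalSpace G] [IsTopologicalGroup G]

omit [IsGalois F (AlgebraicClosure F)] [CompactSpace (absoluteGaloisGroup F)] in
/-- For a continuous `φ : Γ_F → G`, `U ≤ G` normal, `s ∈ G` and `V̄ ≤ G` open normal: the preimage of the trace
`U ∩ V̄` under the conjugated map `ψ_s : φ⁻¹U → U`, `v ↦ s φ(v) s⁻¹` (-w4 g20 `conjHom`), is the trace on `φ⁻¹U` of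
`φ⁻¹V̄` — because `V̄` is normal (`s φ(v) s⁻¹ ∈ V̄ ↔ φ(v) ∈ V̄`). [cite: Harari2020, §17.5 Lemma 17.23][cite: SerreGaloisCohomology1997, I §2.2 Proposition 8] -/
theorem coe_comapOpenNormalSubgroup_conjHom_trace (φ : absoluteGaloisGroup F →* G) (hφ : Continuous φ)
    (U : Subgroup G) [U.Normal] (s : G) (Vbar : OpenNormalSubgroup G) :
    (comapOpenNormalSubgroup (conjHom φ U s) (continuous_conjHom φ hφ U s) (traceOpenNormalSubgroup U Vbar) :
        Subgroup (U.comap φ)) =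
      ((comapOpenNormalSubgroup φ hφ Vbar : OpenNormalSubgroup (absoluteGaloisGroup F)) :
        Subgroup (absoluteGaloisGroup F)).subgroupOf (U.comap φ) := by
  have hn : (Vbar : Subgroup G).Normal := inferInstance
  ext v
  change s * φ (v : absoluteGaloisGroup F) * s⁻¹ ∈ (Vbar : Subgroup G) ↔
    φ (v : absoluteGaloisGroup F) ∈ (Vbar : Subgroup G)
  constructor
  · intro h
    have h' := hn.conj_mem' _ h s
    rwa [← mul_assoc, ← mul_assoc, inv_mul_cancel, one_mul, mul_assoc, inv_mul_cancel, mul_one] at h'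
  · intro h
    exact hn.conj_mem _ h s

omit [IsGalois F (AlgebraicClosure F)] [CompactSpace (absoluteGaloisGroup F)] [IsTopologicalGroup G] in
/-- `φ⁻¹V̄ ≤ φ⁻¹U` when `V̄ ≤ U`. [cite: Harari2020, §17.5 Lemma 17.23] -/
theorem coe_comapOpenNormalSubgroup_le_comap (φ : absoluteGaloisGroup F →* G) (hφ : Continuous φ)
    (U : Subgroup G) (Vbar : OpenNormalSubgroup G) (hVU : (Vbar : Subgroup G) ≤ U) :
    ((comapOpenNormalSubgroup φ hφ Vbar : OpenNormalSubgroup (absoluteGaloisGroup F)) :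
        Subgroup (absoluteGaloisGroup F)) ≤ U.comap φ := fun x hx =>
  Subgroup.mem_comap.2 (hVU ((mem_comapOpenNormalSubgroup_iff φ hφ Vbar x).1 hx))

/-- **Local inflation injectivity in the shape met by [P2-mono]**: for `F̄/F` Galois with `Γ_F` compact, a continuous
`φ : Γ_F → G`, `U ≤ G` open normal, `s ∈ G` and `V̄ ≤ U` open normal in `G`, door-c4's inflation for the group
`V_w := φ⁻¹U`, the open normal subgroup `ψ_s⁻¹(U ∩ V̄)` (`ψ_s = conjHom φ U s`) and the module `Res_{V_w} K̄ˣ`,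
`inflG (comapOpenNormalSubgroup ψ_s _ (traceOpenNormalSubgroup U V̄)) ((resD ℤ (φ⁻¹U)).obj K̄ˣ) 2`, is injective.
This is the map produced from a class inflated from the trace layer `U ∩ V̄` by -w7 g13's
`LayerColimit.mapExactFunctor_resDHom_inflG` along `ψ_s` followed by door-c4's `LayerColimit.inflG_map` for the
conjugated coefficient map `conjCoeff … s : Res_{ψ_s} Res_U B ⟶ Res_{V_w} K̄ˣ`.
[cite: Serre1979, X §4 Proposition 6][cite: Harari2020, §17.5 Lemma 17.23] -/
theorem inflG_comap_conjHom_res_units_two_injective (φ : absoluteGaloisGroup F →* G) (hφ : Continuous φ)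
    (U : Subgroup G) [U.Normal] (hU : IsOpen (U : Set G)) (s : G) (Vbar : OpenNormalSubgroup G)
    (hVU : (Vbar : Subgroup G) ≤ U) :
    Injective (LayerColimit.inflG
      (comapOpenNormalSubgroup (conjHom φ U s) (continuous_conjHom φ hφ U s) (traceOpenNormalSubgroup U Vbar))
      ((resD ℤ (U.comap φ)).obj (ofDiscreteGaloisModule (DiscreteGaloisModule.units F))) 2) :=
  inflG_res_units_two_injective_of_coe_eq F (U.comap φ) (hU.preimage hφ) (comapOpenNormalSubgroup φ hφ Vbar)
    (coe_comapOpenNormalSubgroup_le_comap F φ hφ U Vbar hVU) _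
    (coe_comapOpenNormalSubgroup_conjHom_trace F φ hφ U s Vbar)

end AnyField

/-! ## §4 The completions `K_w` of a number field (`F := Place.Completion w`, `φ := decompMapPlaceS K S w`) -/

section NumberFieldPlaces

open NumberField IsDedekindDomain IdeleReadout
open scoped NumberField

variable (K : Type) [Field K] [NumberField K] (S : Finset (HeightOneSpectrum (𝓞 K))) (w : Place K)

/-- **At a completion `K_w` of a number field (any place `w`)**: for `U ≤ G_S` open normal, `s ∈ G_S` and `V̄ ≤ U` open
normal in `G_S`, the inflation
`inflG (comapOpenNormalSubgroup ψ_s _ (traceOpenNormalSubgroup U V̄)) ((resD ℤ (φ_w⁻¹U)).obj (unitsD K_w)) 2`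
(`φ_w = decompMapPlaceS K S w`, `ψ_s = conjHom φ_w U s`, `unitsD K_w = K̄_wˣ`) is injective — the local leaf of
[P2-mono]: the `(w, t)`-component (`s = s_t`) of a class of `Ext²_{C_U}(ℤ, Res_U I_S)` inflated from the trace layer
`U ∩ V̄_E` vanishes iff its finite-level datum in `H²(φ_w⁻¹U ⧸ ψ_s⁻¹(U ∩ V̄_E), ((K̄_wˣ))^{…})` vanishes.
(`K_w` has characteristic `0`, so `K̄_w/K_w` is Galois; `Γ_{K_w}` is compact by `absoluteGaloisGroup_compactSpace`.)
[cite: Serre1979, X §4 Proposition 6][cite: Harari2020, §17.5 Lemma 17.23][cite: CasselsFrohlichANT1967, Ch. VII §11.1] -/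
theorem inflG_comap_conjHom_res_unitsD_completion_two_injective
    (U : Subgroup (GaloisGroupUnramifiedOutside K (↑S : Set (HeightOneSpectrum (𝓞 K))))) [U.Normal]
    (hU : IsOpen (U : Set (GaloisGroupUnramifiedOutside K (↑S : Set (HeightOneSpectrum (𝓞 K))))))
    (s : GaloisGroupUnramifiedOutside K (↑S : Set (HeightOneSpectrum (𝓞 K))))
    (Vbar : OpenNormalSubgroup (GaloisGroupUnramifiedOutside K (↑S : Set (HeightOneSpectrum (𝓞 K)))))
    (hVU : (Vbar : Subgroup (GaloisGroupUnramifiedOutside K (↑S : Set (HeightOneSpectrum (𝓞 K))))) ≤ U) :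
    Injective (LayerColimit.inflG
      (comapOpenNormalSubgroup (conjHom (decompMapPlaceS K S w) U s)
        (continuous_conjHom (decompMapPlaceS K S w) (continuous_decompMapPlaceS K S w) U s)
        (traceOpenNormalSubgroup U Vbar))
      ((resD ℤ (U.comap (decompMapPlaceS K S w))).obj (unitsD (Place.Completion w))) 2) :=
  haveI : CharZero (Place.Completion w) :=
    charZero_of_injective_algebraMap (algebraMap K (Place.Completion w)).injective
  haveI : IsGalois (Place.Completion w) (AlgebraicClosure (Place.Completion w)) := {}
  haveI : CompactSpace (absoluteGaloisGroup (Place.Completion w)) := absoluteGaloisGroup_compactSpace _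
  inflG_comap_conjHom_res_units_two_injective (Place.Completion w) (decompMapPlaceS K S w)
    (continuous_decompMapPlaceS K S w) U hU s Vbar hVU

/-- **At a completion `K_w`, subgroup-equation form**: for `V ≤ Γ_{K_w}` open, `W ≤ V` open normal in `Γ_{K_w}` and any
open normal `N ≤ V` with `N = W ∩ V` as subgroups, `inflG N ((resD ℤ V).obj (unitsD K_w)) 2` is injective.
[cite: Serre1979, X §4 Proposition 6][cite: SerreGaloisCohomology1997, I §2.2 Proposition 8] -/
theorem inflG_res_unitsD_completion_two_injective_of_coe_eq
    (V : Subgroup (absoluteGaloisGroup (Place.Completion w)))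
    (hV : IsOpen (V : Set (absoluteGaloisGroup (Place.Completion w))))
    (W : OpenNormalSubgroup (absoluteGaloisGroup (Place.Completion w)))
    (hW : (W : Subgroup (absoluteGaloisGroup (Place.Completion w))) ≤ V) (N : OpenNormalSubgroup V)
    (hN : (N : Subgroup V) = (W : Subgroup (absoluteGaloisGroup (Place.Completion w))).subgroupOf V) :
    Injective (LayerColimit.inflG N ((resD ℤ V).obj (unitsD (Place.Completion w))) 2) :=
  haveI : CharZero (Place.Completion w) :=
    charZero_of_injective_algebraMap (algebraMap K (Place.Completion w)).injective
  haveI : IsGalois (Place.Completion w) (AlgebraicClosure (Place.Completion w)) := {}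
  haveI : CompactSpace (absoluteGaloisGroup (Place.Completion w)) := absoluteGaloisGroup_compactSpace _
  inflG_res_units_two_injective_of_coe_eq (Place.Completion w) V hV W hW N hN

end NumberFieldPlaces

end Literature.NumberTheory.GaloisRepresentations

end
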